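import Summits.AtomisticToContinuum.FouriersLaw.Theorems.PuiseuxTransferLedgerTwoModeBulkCorrectorIdentityBond

/-!
# Corrector identity for the two-mode profile, part 4: the profile on the finite-volume Green–Kubo corrector
(helper, `--supports` crux stmt-AtomisticToContinuum-12111 `PuiseuxTransferLedger.TwoModeBulk`, line `Sketch`)

For the pinned anharmonic chain `P = pinnedChain ω₂ lam β γ` (`ω₂ > 0`, `lam ≥ 0`, `β, γ > 0`) with `N + 1` sites
(`N ≥ 1`), both baths at `T > 0`, `μ₀ = gibbsMeasure (N+1) T`, `K_s = transitionKernel (N+1) T T s`, the total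
current observable `J = ∑_b j_b` and the crux's explicit profile
`u_N(i) = (γ/T²) ∫₀^∞ Cov_{μ₀}(p_0², K_s p_i²) ds - 1/2` (`TwoModeProfile`, `profileValue` of line `Sketch`):

* `pinnedChain_correctorIdentity` — **THE CORRECTOR IDENTITY**
  `u_N(i) = 1/2 - i/N + (N T²)⁻¹ ∫₀^∞ Cov_{μ₀}(J, K_s p_i²) ds`,
  the last integrand integrable on `(0, ∞)`: the profile is the perfect Ohmic profile `1/2 - i/N` minus the kinetic
  profile `W_N(i) = -(N T²)⁻¹ ∫₀^∞ Cov_{μ₀}(J, K_s p_i²) ds` of the finite-volume Green–Kubo corrector (crux-strategist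
  census, `Cruxes/TwoModeBulk/STRATEGY-CENSUS.md` §Transfer 9, identity (★)). Hence `TwoModeBulk` ⇔ the increments of
  `i ↦ ∫₀^∞ Cov_{μ₀}(J, K_s p_i²) ds` are `N T²(1/N - r g_N)` up to `O(N T² g_N (θ^i + θ^{N-1-i}))`, uniformly in `N`.
  Proof: average the bond-resolved identities of part 3 (`pinnedChain_correctorIdentity_bond`) over the `N` genuine
  bonds `m < N`: `∑_{m<N} [i ≤ m] = N - i`, `∑_{m<N} j_m = J` (no bond starts at the last site).
No definitions; nothing here closes the item.
-/

noncomputable section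

open scoped NNReal ENNReal Topology
open MeasureTheory Filter Set

namespace Summit.AtomisticToContinuum.FouriersLaw.Theorems.TwoModeBulk.Sketch

open Literature.MathematicalPhysics.KineticTheory.HeatConduction
open Literature.MathematicalPhysics.KineticTheory Literature.Probability.Process OscillatorChain
open ProbabilityTheory
open Summit.AtomisticToContinuum.FouriersLaw.Theorems.SubdiffusiveBondHeat
open Summit.AtomisticToContinuum.FouriersLaw.Theorems.IncoherentBounded
open Summit.AtomisticToContinuum.FouriersLaw.Theorems.BoundaryKubo.GibbsTtcf
open Summit.AtomisticToContinuum.FouriersLaw.Theorems.LightConeBondHeat (pinnedChain_abs_bondCurrent_le_exp)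
open Summit.AtomisticToContinuum.FouriersLaw.Theorems.BoundaryKubo.Negative.Reflection (bondCurrent_eq_zero_of_not_lt)

/-- `∑_{m < N} [i ≤ m] = N - i` for `i ≤ N`. [folklore] -/
theorem sum_indicator_le_eq_sub {N : ℕ} (i : Fin (N + 1)) :
    ∑ m : Fin N, (if i.val ≤ (Fin.castSucc m).val then (1 : ℝ) else 0) = (N : ℝ) - (i.val : ℝ) := by
  have hi : i.val ≤ N := Nat.lt_succ_iff.1 i.isLt
  have h1 : ∑ m : Fin N, (if i.val ≤ (Fin.castSucc m).val then (1 : ℝ) else 0) =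
      ∑ k ∈ Finset.range N, (if i.val ≤ k then (1 : ℝ) else 0) :=
    Fin.sum_univ_eq_sum_range (fun k => if i.val ≤ k then (1 : ℝ) else 0) N
  rw [h1, Finset.range_eq_Ico, ← Finset.sum_Ico_consecutive _ (Nat.zero_le i.val) hi]
  have h2 : ∑ k ∈ Finset.Ico 0 i.val, (if i.val ≤ k then (1 : ℝ) else 0) = 0 :=
    Finset.sum_eq_zero fun k hk => by
      rw [Finset.mem_Ico] at hk
      rw [if_neg (by omega)]
  have h3 : ∑ k ∈ Finset.Ico i.val N, (if i.val ≤ k then (1 : ℝ) else 0) = ∑ k ∈ Finset.Ico i.val N, (1 : ℝ) :=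
    Finset.sum_congr rfl fun k hk => by
      rw [Finset.mem_Ico] at hk
      rw [if_pos hk.1]
  rw [h2, h3, zero_add, Finset.sum_const, Nat.card_Ico, nsmul_eq_mul, mul_one, Nat.cast_sub hi]

/-- **The corrector identity.** For the pinned anharmonic chain with `N + 1` sites (`N ≥ 1`; `ω₂ > 0`, `lam ≥ 0`,
`β, γ > 0`), `T > 0`, a site `i`, `μ₀ = gibbsMeasure (N+1) T`, `K_s = transitionKernel (N+1) T T s`, the total current
`J = ∑_b j_b`: `s ↦ μ₀(J · K_s p_i²) - μ₀(J) μ₀(K_s p_i²)` is integrable on `(0, ∞)` and the explicit profile of the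
crux satisfies
`(γ/T²) ∫₀^∞ (μ₀(p_0² · K_s p_i²) - μ₀(p_0²) μ₀(K_s p_i²)) ds - 1/2
   = 1/2 - i/N + (N T²)⁻¹ ∫₀^∞ (μ₀(J · K_s p_i²) - μ₀(J) μ₀(K_s p_i²)) ds`
(average of the bond-resolved identities `pinnedChain_correctorIdentity_bond` over the bonds `m < N`). [folklore] -/
theorem pinnedChain_correctorIdentity {ω₂ lam β γ : ℝ} (hω : 0 < ω₂) (hl : 0 ≤ lam) (hβ : 0 < β) (hγ : 0 < γ)
    {N : ℕ} (hN : 0 < N) {T : ℝ} (hT : 0 < T) (i : Fin (N + 1)) :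
    IntegrableOn (fun s : ℝ =>
        (∫ z, (∑ b : Fin (N + 1), (pinnedChain ω₂ lam β γ).bondCurrent (N + 1) b z) * (∫ y, (y.2 i) ^ 2
          ∂((pinnedChain ω₂ lam β γ).transitionKernel (N + 1) T T s.toNNReal z))
          ∂((pinnedChain ω₂ lam β γ).gibbsMeasure (N + 1) T)) -
        (∫ z, (∑ b : Fin (N + 1), (pinnedChain ω₂ lam β γ).bondCurrent (N + 1) b z)
          ∂((pinnedChain ω₂ lam β γ).gibbsMeasure (N + 1) T)) *
          (∫ z, (∫ y, (y.2 i) ^ 2 ∂((pinnedChain ω₂ lam β γ).transitionKernel (N + 1) T T s.toNNReal z))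
            ∂((pinnedChain ω₂ lam β γ).gibbsMeasure (N + 1) T))) (Ioi 0) ∧
    γ / T ^ 2 * (∫ s in Ioi (0 : ℝ),
        ((∫ z, (z.2 0) ^ 2 * (∫ y, (y.2 i) ^ 2
          ∂((pinnedChain ω₂ lam β γ).transitionKernel (N + 1) T T s.toNNReal z))
          ∂((pinnedChain ω₂ lam β γ).gibbsMeasure (N + 1) T)) -
        (∫ z, (z.2 0) ^ 2 ∂((pinnedChain ω₂ lam β γ).gibbsMeasure (N + 1) T)) *
          (∫ z, (∫ y, (y.2 i) ^ 2 ∂((pinnedChain ω₂ lam β γ).transitionKernel (N + 1) T T s.toNNReal z))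
            ∂((pinnedChain ω₂ lam β γ).gibbsMeasure (N + 1) T)))) - 1 / 2 =
      1 / 2 - (i.val : ℝ) / N + 1 / (N * T ^ 2) *
      ∫ s in Ioi (0 : ℝ),
        ((∫ z, (∑ b : Fin (N + 1), (pinnedChain ω₂ lam β γ).bondCurrent (N + 1) b z) * (∫ y, (y.2 i) ^ 2
          ∂((pinnedChain ω₂ lam β γ).transitionKernel (N + 1) T T s.toNNReal z))
          ∂((pinnedChain ω₂ lam β γ).gibbsMeasure (N + 1) T)) -
        (∫ z, (∑ b : Fin (N + 1), (pinnedChain ω₂ lam β γ).bondCurrent (N + 1) b z)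
          ∂((pinnedChain ω₂ lam β γ).gibbsMeasure (N + 1) T)) *
          (∫ z, (∫ y, (y.2 i) ^ 2 ∂((pinnedChain ω₂ lam β γ).transitionKernel (N + 1) T T s.toNNReal z))
            ∂((pinnedChain ω₂ lam β γ).gibbsMeasure (N + 1) T))) := by
  -- notation
  set P := pinnedChain ω₂ lam β γ with hPdef
  have hP : P.IsConfining := pinnedChain_isConfining hω hl hβ.le hγ.le
  set μ := P.gibbsMeasure (N + 1) T with hμ
  haveI : IsProbabilityMeasure μ := pinnedChain_isProbabilityMeasure_gibbsMeasure hω hl hβ.le γ (N + 1) hT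
  set K : ℝ≥0 → Kernel (PhaseSpace (N + 1)) (PhaseSpace (N + 1)) := P.transitionKernel (N + 1) T T with hK
  set Hm := P.hamiltonian (N + 1) with hHm
  set A : PhaseSpace (N + 1) → ℝ := fun y => (y.2 i) ^ 2 with hA
  set B : PhaseSpace (N + 1) → ℝ := fun y => (y.2 0) ^ 2 with hB
  set KA : ℝ → PhaseSpace (N + 1) → ℝ := fun t z => ∫ y, A y ∂(K t.toNNReal z) with hKA
  set jb : Fin (N + 1) → PhaseSpace (N + 1) → ℝ := fun b z => P.bondCurrent (N + 1) b z with hjb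
  set Jt : PhaseSpace (N + 1) → ℝ := fun z => ∑ b : Fin (N + 1), jb b z with hJt
  set Y : ℝ → ℝ := fun t => (∫ z, B z * KA t z ∂μ) - (∫ z, B z ∂μ) * (∫ z, KA t z ∂μ) with hY
  set Jc : Fin (N + 1) → ℝ → ℝ := fun b t => (∫ z, jb b z * KA t z ∂μ) - (∫ z, jb b z ∂μ) * (∫ z, KA t z ∂μ) with hJc
  set JcJ : ℝ → ℝ := fun t => (∫ z, Jt z * KA t z ∂μ) - (∫ z, Jt z ∂μ) * (∫ z, KA t z ∂μ) with hJcJ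
  show IntegrableOn JcJ (Ioi 0) ∧ γ / T ^ 2 * (∫ t in Ioi (0:ℝ), Y t) - 1 / 2 =
    1 / 2 - (i.val : ℝ) / N + 1 / (N * T ^ 2) * ∫ t in Ioi (0:ℝ), JcJ t
  -- the bond-resolved identities for the genuine bonds `m < N`
  have hbond : ∀ m : Fin N, IntegrableOn (Jc (Fin.castSucc m)) (Ioi 0) ∧
      γ * (∫ t in Ioi (0:ℝ), Y t) = T ^ 2 * (if i.val ≤ (Fin.castSucc m).val then 1 else 0) +
        ∫ t in Ioi (0:ℝ), Jc (Fin.castSucc m) t := fun m =>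
    pinnedChain_correctorIdentity_bond hω hl hβ hγ N hT i (Fin.castSucc m) (by simp)
  -- exponential bounds and integrability of the current kernels under `μ₀`
  have hϑ0 : (0:ℝ) < 1 / (4 * T) := by positivity
  have hϑ1 : 1 / (4 * T) < 1 / T := by
    have : 2 * (1 / (4 * T)) < 1 / T := by
      rw [show 2 * (1 / (4 * T)) = 1 / (2 * T) by field_simp; ring]
      exact one_div_lt_one_div_of_lt hT (by linarith)
    linarith
  have hAc : Continuous A := by rw [hA]; fun_prop
  have hAb : ∀ y, |A y| ≤ 2 / (1 / (4 * T)) * Real.exp (1 / (4 * T) * Hm y) := fun y =>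
    abs_sq_momentum_le_exp hP hϑ0 (N + 1) y _
  have hjc : ∀ b, Continuous (jb b) := fun b => pinnedChain_continuous_bondCurrent ω₂ lam β γ (N + 1) b
  set CJ : ℝ := ((N + 1 : ℕ) : ℝ) * ((3 + β) / 2) * (2 * Real.exp (1 / (4 * T)) / (1 / (4 * T)) ^ 2) with hCJ
  have hjbd : ∀ b y, |jb b y| ≤ CJ * Real.exp (1 / (4 * T) * Hm y) := fun b y =>
    pinnedChain_abs_bondCurrent_le_exp hω.le hl hβ.le γ (N + 1) hϑ0 b y
  have hwt1 := pinnedChain_integrable_exp_mul_hamiltonian_gibbsMeasure hω hl hβ.le γ (N + 1) hT hϑ1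
  have hji : ∀ b, Integrable (jb b) μ := fun b => integrable_of_abs_le_exp hwt1 (hjc b) (hjbd b)
  have hjKi : ∀ b (t : ℝ), Integrable (fun z => jb b z * KA t z) μ := fun b t =>
    integrable_mul_act hω hl hβ hγ hT (hjc b) hAc (hjbd b) hAb t.toNNReal
  -- the last site carries no bond: `∑_{m<N} j_m = J`
  have hlast : ∀ z, jb (Fin.last N) z = 0 := fun z =>
    bondCurrent_eq_zero_of_not_lt P (by simp) z
  have hJsum : ∀ z, ∑ m : Fin N, jb (Fin.castSucc m) z = Jt z := fun z => by
    simp only [hJt]; rw [Fin.sum_univ_castSucc, hlast z, add_zero]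
  -- `∑_{m<N} Jc_m = JcJ`
  have hJcsum : ∀ t, ∑ m : Fin N, Jc (Fin.castSucc m) t = JcJ t := by
    intro t
    simp only [hJc, hJcJ]
    rw [Finset.sum_sub_distrib, ← Finset.sum_mul, ← integral_finsetSum _ (fun m _ => hjKi _ t),
      ← integral_finsetSum _ (fun m _ => hji _)]
    have e1 : ∀ z, ∑ m : Fin N, jb (Fin.castSucc m) z * KA t z = Jt z * KA t z := fun z => by
      rw [← Finset.sum_mul, hJsum z]
    simp_rw [e1, hJsum]
  have hJint : IntegrableOn JcJ (Ioi 0) := by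
    have h : IntegrableOn (fun t => ∑ m : Fin N, Jc (Fin.castSucc m) t) (Ioi 0) :=
      integrable_finsetSum _ fun m _ => (hbond m).1
    exact h.congr_fun (fun t _ => hJcsum t) measurableSet_Ioi
  refine ⟨hJint, ?_⟩
  -- sum the bond identities
  have hsumId : (N : ℝ) * (γ * ∫ t in Ioi (0:ℝ), Y t) =
      T ^ 2 * ((N : ℝ) - (i.val : ℝ)) + ∫ t in Ioi (0:ℝ), JcJ t := by
    have h := Finset.sum_congr rfl fun (m : Fin N) (_ : m ∈ Finset.univ) => (hbond m).2
    rw [Finset.sum_const, Finset.card_univ, Fintype.card_fin, nsmul_eq_mul, Finset.sum_add_distrib,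
      ← Finset.mul_sum, sum_indicator_le_eq_sub i,
      ← integral_finsetSum _ (fun m _ => (hbond m).1)] at h
    rw [h]
    congr 1
    exact integral_congr_ae (Eventually.of_forall fun t => hJcsum t)
  have hNr : (0 : ℝ) < N := by exact_mod_cast hN
  have hN0 : (N : ℝ) ≠ 0 := hNr.ne'
  have hT0 : T ≠ 0 := hT.ne'
  have hIY : ∫ t in Ioi (0:ℝ), Y t = (T ^ 2 * ((N : ℝ) - (i.val : ℝ)) + ∫ t in Ioi (0:ℝ), JcJ t) / ((N : ℝ) * γ) := by
    rw [eq_div_iff (mul_ne_zero hN0 hγ.ne')]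
    linarith [hsumId]
  rw [hIY]
  field_simp
  ring

/-- **Registered sub-goal `twoModeBulk_correctorIdentity`** of crux stmt-AtomisticToContinuum-12111 (line `Sketch`,
corrector identity (★), part 4): `pinnedChain_correctorIdentity` as a closed statement — for the `(N+1)`-site pinned
chain (`N ≥ 1`; `ω₂ > 0`, `lam ≥ 0`, `β, γ > 0`), `T > 0`, site `i`:
`u_N(i) = (γ/T²)∫₀^∞ Cov_{μ₀}(p_0², K_s p_i²) ds - 1/2 = 1/2 - i/N + (N T²)⁻¹ ∫₀^∞ Cov_{μ₀}(J, K_s p_i²) ds`, the last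
integrand integrable on `(0, ∞)`. [folklore] -/
theorem twoModeBulk_correctorIdentity :
    ∀ ω₂ lam β γ : ℝ, 0 < ω₂ → 0 ≤ lam → 0 < β → 0 < γ → ∀ (N : ℕ), 0 < N → ∀ (T : ℝ), 0 < T → ∀ (i : Fin (N + 1)), MeasureTheory.IntegrableOn (fun s : ℝ => ((∫ z, (∑ b : Fin (N + 1), (Literature.MathematicalPhysics.KineticTheory.HeatConduction.pinnedChain ω₂ lam β γ).bondCurrent (N + 1) b z) * (∫ y, (y.2 i) ^ 2 ∂((Literature.MathematicalPhysics.KineticTheory.HeatConduction.pinnedChain ω₂ lam β γ).transitionKernel (N + 1) T T s.toNNReal z)) ∂((Literature.MathematicalPhysics.KineticTheory.HeatConduction.pinnedChain ω₂ lam β γ).gibbsMeasure (N + 1) T)) - (∫ z, (∑ b : Fin (N + 1), (Literature.MathematicalPhysics.KineticTheory.HeatConduction.pinnedChain ω₂ lam β γ).bondCurrent (N + 1) b z) ∂((Literature.MathematicalPhysics.KineticTheory.HeatConduction.pinnedChain ω₂ lam β γ).gibbsMeasure (N + 1) T)) * (∫ z, (∫ y, (y.2 i) ^ 2 ∂((Literature.MathematicalPhysics.KineticTheory.HeatConduction.pinnedChain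 ω₂ lam β γ).transitionKernel (N + 1) T T s.toNNReal z)) ∂((Literature.MathematicalPhysics.KineticTheory.HeatConduction.pinnedChain ω₂ lam β γ).gibbsMeasure (N + 1) T)))) (Set.Ioi 0) ∧ γ / T ^ 2 * (∫ s in Set.Ioi (0 : ℝ), ((∫ z, (z.2 0) ^ 2 * (∫ y, (y.2 i) ^ 2 ∂((Literature.MathematicalPhysics.KineticTheory.HeatConduction.pinnedChain ω₂ lam β γ).transitionKernel (N + 1) T T s.toNNReal z)) ∂((Literature.MathematicalPhysics.KineticTheory.HeatConduction.pinnedChain ω₂ lam β γ).gibbsMeasure (N + 1) T)) - (∫ z, (z.2 0) ^ 2 ∂((Literature.MathematicalPhysics.KineticTheory.HeatConduction.pinnedChain ω₂ lam β γ).gibbsMeasure (N + 1) T)) * (∫ z, (∫ y, (y.2 i) ^ 2 ∂((Literature.MathematicalPhysics.KineticTheory.HeatConduction.pinnedChain ω₂ lam β γ).transitionKernel (N + 1) T T s.toNNReal z)) ∂((Literature.MathematicalPhysics.KineticTheory.HeatConduction.pinnedChain ω₂ lam β γ).gibbsMeasure (N + 1) T)))) - 1 / 2 = 1 / 2 - (i.val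 : ℝ) / N + 1 / (N * T ^ 2) * ∫ s in Set.Ioi (0 : ℝ), ((∫ z, (∑ b : Fin (N + 1), (Literature.MathematicalPhysics.KineticTheory.HeatConduction.pinnedChain ω₂ lam β γ).bondCurrent (N + 1) b z) * (∫ y, (y.2 i) ^ 2 ∂((Literature.MathematicalPhysics.KineticTheory.HeatConduction.pinnedChain ω₂ lam β γ).transitionKernel (N + 1) T T s.toNNReal z)) ∂((Literature.MathematicalPhysics.KineticTheory.HeatConduction.pinnedChain ω₂ lam β γ).gibbsMeasure (N + 1) T)) - (∫ z, (∑ b : Fin (N + 1), (Literature.MathematicalPhysics.KineticTheory.HeatConduction.pinnedChain ω₂ lam β γ).bondCurrent (N + 1) b z) ∂((Literature.MathematicalPhysics.KineticTheory.HeatConduction.pinnedChain ω₂ lam β γ).gibbsMeasure (N + 1) T)) * (∫ z, (∫ y, (y.2 i) ^ 2 ∂((Literature.MathematicalPhysics.KineticTheory.HeatConduction.pinnedChain ω₂ lam β γ).transitionKernel (N + 1) T T s.toNNReal z)) ∂((Literature.MathematicalPhysics.KineticTheory.HeatConduction.pinnedChain ω₂ lam β γ).gibbsMeasure (N + 1)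 T))) :=
  fun _ _ _ _ hω hl hβ hγ _ hN _ hT i => pinnedChain_correctorIdentity hω hl hβ hγ hN hT i

end Summit.AtomisticToContinuum.FouriersLaw.Theorems.TwoModeBulk.Sketch

end
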